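import Summits.QuantumFields.BalabanUV.Beta.GAN24.DerivativeRateTransferSqueezeEnd
import Summits.QuantumFields.BalabanUV.Beta.GAN24.DerivativeRateTransferAccretiveBound

/-!
# `BalabanUV.Beta.GAN24.DerivativeRateTransferAccretiveEnd` — binder row G-an2-4 ∕ (CONV-C), route R6 «VALUES, NOT DERIVATIVES», PART 37:
# «ACCRETIVE S2», THE END ON THE AXIAL SLICE — PART 32's capstone `dEffForm_step_rateω_of_stabGram_of_prolGram_of_row` with its complex letter
# S2 (`hdet` + `hB`) DISCHARGED, for towers whose constraint maps do not move (`Q₁ = Q₂ = 0`), from REAL-BIDISC letters: PSD and real nonsingularity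
# of `(H_k + sH₁ₖ + tH₂ₖ, Q_k)`, the sector letter `±H_iₖ ≤ c·(H_k + sH₁ₖ + tH₂ₖ + a₀Q_kᵀQ_k)` and the row bound `Λ` on `|s|, |t| < ρ`
# (unit b2b-balaban-gan24-p3, gen 39; gan24-idea-1 g45's lens item «ACCRETIVE S2», Q-45-1 ∕ Q-45-1′, the H-jet half)

NOT IN PRINT; OUR PROOF (for the ROUTE; [folklore] — PART 35 `isUnit_det_kkt_accretive`, PART 36 `norm_effForm_accretive_apply_le_of_reg` ∕ `loewner_of_jet_letters` ∕
`affine₂_map_eq_accretive`, PART 32 `dEffForm_step_rateω_of_stabGram_of_prolGram_of_row` BY NAME).  HONEST FRAMING (cell contract, verbatim): «discharging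
`BetaPertH` makes Bałaban's UV stability UNCONDITIONAL — a real constructive-QFT result; it is NOT the continuum limit and NOT the Clay problem.»  HONEST
DEPENDENCY (verbatim): «continuum YM on T⁴ ⇐ BetaPertH ∧ nine spine estimates (0/9 proved); BetaPertH ⇐ (D1) ∧ (D4) ∧ CAP+tail; G-an2-4 gates asym, D1 and NE2/3/4.»

WHY THIS FILE.  Route R6's debt line after gen 38 reads «(PROL-ε,δ)(s,t) + (ROW)(s,t) + Λ + S2(ii) + κ-junction rates + N + (H2)∕S2»; the «(H2)∕S2» entry is
PART 32 END's pair `hdet` ∕ `hB` on the complex bidisc, supplied so far only by PARTs 10∕11's Neumann road (a radius in EVERY jet).  For the H-JETS no radius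
is needed: §1 reads the complexified affine family at `z = x + iy` as the accretive datum `(Â(x) + i•K̂(y), Q̂)` (PART 36 `affine₂_map_eq_accretive`) and
takes `hdet` from PART 35 (D) and `hB` from PART 36 (A′) with `κ = 2ρc` (PART 36 `loewner_of_jet_letters`, `|Im z_i| ≤ ‖z_i‖ < ρ`); §2 feeds both to
PART 32.  NET for the debt line, H-jet half: «(H2)∕S2 ↦ REAL letters on the real bidisc: PSD + real nonsingularity [the (1.67)-LOWER class with
background] + the sector letter `±H_iₖ ≤ c·(H_k(s,t) + a₀Q_kᵀQ_k)` k-uniform [an1 g73 W-4: A NEW ROW] + Λ [(1.67)-UPPER class]»; the Q-jets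
(`Q₁ₖ, Q₂ₖ ≠ 0`, [B9] p. 417 (3.110)) remain perturbative (constraint straightening inside `ρ_Q ~ 1∕(2·sup_k‖ℋ_kQ_iₖ‖)`, gan24-idea-1 g45 Q-45-1′ (i)∕(iii)).

WHAT THIS FILE PROVES (0 sorry, 0 `def`, nothing cited):
* §1 **`isUnit_det_kkt_affine₂_of_real`** (`hdet` on the bidisc ⇐ PSD + real nonsingularity on the real bidisc, `H₁, H₂` symmetric; NO radius in `Im z`),
  `posSemidef_add_reg`, `transpose_eq_of_loewner`, **`norm_effForm_affine₂_le_of_real`** (`hB` with `B = (1 + 2ρc·√(2 + (2ρc)²))·(Λ + a₀) + a₀`).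
* §2 **`dEffForm_step_rateω_of_stabGram_of_prolGram_of_row_of_real`** — PART 32's capstone on the axial slice with S2 DISCHARGED:
  `‖dEffForm_{k+1} − dEffForm_k‖ ≤ 25·(2B)^r∕(s₁r²)·C^{1−r}·(θ^{1−r})^k`, `C = (1 + cε + 2cε′ + cϱ)·Λ + (cδ + 2cδ′)·N`, every `r ∈ ]0,1]`.
WHAT IT DOES NOT DO: the Q-jets; produce the tower data, (STAB-ε′,δ′), (PROL-ε,δ), (ROW), `Λ`, `N`, the sector letter or S2(ii) for any of Bałaban's
operators.  SUPPLIER work on route R6 (rank 2, REDUCTION, no seat); no consumer of record; NEVER «G-an2-4 closed»; NOT (CONV-C), NOT D1, NOT `BetaPertH`,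
NOT continuum, NOT Clay.  Records: `HOME/b2b-balaban-gan24-p3/WOODBURY-FIBRE.md` v13.9.
-/

noncomputable section

open Set Metric Matrix
open scoped ComplexOrder

namespace Summit.QuantumFields.BalabanUV.Beta.GAN24.DerivativeRateTransferAccretiveEnd

open Literature.MathematicalPhysics.QuantumFieldTheory.Balaban1983to89.Beta.Composition (kkt)
open Literature.MathematicalPhysics.QuantumFieldTheory.Balaban1983to89.Beta.CompositionSingular (effForm minOp)
open Literature.MathematicalPhysics.QuantumFieldTheory.Balaban1983to89.Beta.BorderedJets (dEffForm)
open Summit.QuantumFields.BalabanUV.Beta.GAN24.DerivativeRateTransferLoewnerKKT (transpose_eq_of_posSemidef)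
open Summit.QuantumFields.BalabanUV.Beta.GAN24.DerivativeRateTransferSqueezeEnd (dEffForm_step_rateω_of_stabGram_of_prolGram_of_row)
open Summit.QuantumFields.BalabanUV.Beta.GAN24.DerivativeRateTransferAccretive (isUnit_det_kkt_accretive)
open Summit.QuantumFields.BalabanUV.Beta.GAN24.DerivativeRateTransferAccretiveBound (norm_effForm_accretive_apply_le_of_reg loewner_of_jet_letters
  affine₂_map_eq_accretive)

/-! ## §1 `hdet` and `hB` on the bidisc from real-bidisc letters (axial slice) -/

section Slice

variable {ν μ : Type*} [Fintype ν] [Fintype μ] [DecidableEq ν] [DecidableEq μ]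
variable {H H₁ H₂ : Matrix ν ν ℝ} {Q : Matrix μ ν ℝ} {ρ c a₀ Λ : ℝ}

omit [Fintype ν] [Fintype μ] [DecidableEq ν] [DecidableEq μ] in
/-- [folklore] a point of the complex bidisc has its real and imaginary parts in the real bidisc. -/
theorem re_im_lt_of_mem_bidisc {z : ℂ × ℂ} (hz : z ∈ ball (0 : ℂ) ρ ×ˢ ball (0 : ℂ) ρ) :
    |z.1.re| < ρ ∧ |z.2.re| < ρ ∧ |z.1.im| < ρ ∧ |z.2.im| < ρ := by
  obtain ⟨h1, h2⟩ := hz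
  rw [mem_ball_zero_iff] at h1 h2
  exact ⟨(Complex.abs_re_le_norm _).trans_lt h1, (Complex.abs_re_le_norm _).trans_lt h2, (Complex.abs_im_le_norm _).trans_lt h1,
    (Complex.abs_im_le_norm _).trans_lt h2⟩

/-- **`isUnit_det_kkt_affine₂_of_real` — `hdet` ON THE BIDISC FROM THE REAL BIDISC** [our proof; PART 35 (D)]: `H + sH₁ + tH₂` PSD with `kkt(H + sH₁ + tH₂, Q)`
nonsingular for all real `|s|, |t| < ρ`, `H₁, H₂` symmetric ⟹ the complexified bordered matrix `kkt(Ĥ + z₁Ĥ₁ + z₂Ĥ₂, Q̂)` is nonsingular on the whole complex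
bidisc — NO radius in `Im z`. -/
theorem isUnit_det_kkt_affine₂_of_real (hA : ∀ s t : ℝ, |s| < ρ → |t| < ρ → (H + s • H₁ + t • H₂).PosSemidef)
    (hk : ∀ s t : ℝ, |s| < ρ → |t| < ρ → IsUnit (kkt (H + s • H₁ + t • H₂) Q).det) (hH₁ : H₁ᵀ = H₁) (hH₂ : H₂ᵀ = H₂) :
    ∀ z ∈ ball (0 : ℂ) ρ ×ˢ ball (0 : ℂ) ρ,
      IsUnit (kkt (H.map (Complex.ofRealHom : ℝ →+* ℂ) + z.1 • H₁.map Complex.ofRealHom + z.2 • H₂.map Complex.ofRealHom)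
        (Q.map Complex.ofRealHom)).det := by
  intro z hz
  obtain ⟨hx1, hx2, -, -⟩ := re_im_lt_of_mem_bidisc hz
  have hK : (z.1.im • H₁ + z.2.im • H₂)ᵀ = z.1.im • H₁ + z.2.im • H₂ := by
    rw [transpose_add, transpose_smul, transpose_smul, hH₁, hH₂]
  rw [affine₂_map_eq_accretive]
  exact isUnit_det_kkt_accretive (hA _ _ hx1 hx2) hK (hk _ _ hx1 hx2)

omit [DecidableEq ν] in
/-- [folklore] the `a₀`-regularised form of a PSD form is PSD (`0 ≤ a₀`). -/
theorem posSemidef_add_reg {A : Matrix ν ν ℝ} (hA : A.PosSemidef) (ha : 0 ≤ a₀) : (A + Qᵀ * (a₀ • (1 : Matrix μ μ ℝ)) * Q).PosSemidef := by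
  have e : Qᵀ * (a₀ • (1 : Matrix μ μ ℝ)) * Q = a₀ • (Qᴴ * Q) := by
    rw [conjTranspose_eq_transpose_of_trivial, Matrix.mul_smul, Matrix.mul_one, Matrix.smul_mul]
  rw [e]; exact hA.add ((posSemidef_conjTranspose_mul_self Q).smul ha)

omit [Fintype ν] [Fintype μ] [DecidableEq ν] [DecidableEq μ] in
/-- [folklore] a two-sided Loewner letter makes the jet symmetric: `cA − H₁ ≥ 0`, `cA + H₁ ≥ 0` ⟹ `H₁ᵀ = H₁`. -/
theorem transpose_eq_of_loewner {A : Matrix ν ν ℝ} (hm : (c • A - H₁).PosSemidef) (hp : (c • A + H₁).PosSemidef) : H₁ᵀ = H₁ := by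
  have h1 := transpose_eq_of_posSemidef hm
  have h2 := transpose_eq_of_posSemidef hp
  ext i j
  have e1 := congrFun (congrFun h1 i) j
  have e2 := congrFun (congrFun h2 i) j
  simp only [Matrix.transpose_apply, Matrix.sub_apply, Matrix.add_apply, Matrix.smul_apply, smul_eq_mul] at e1 e2
  rw [Matrix.transpose_apply]
  linarith

/-- **`norm_effForm_affine₂_le_of_real` — `hB` ON THE BIDISC FROM THE REAL BIDISC** [our proof; PART 36 (A′) + `loewner_of_jet_letters`]: for real `|s|,|t| < ρ`:
`H + sH₁ + tH₂` PSD, `kkt(·, Q)` nonsingular, the SECTOR LETTER `±H_i ≤ c·(H + sH₁ + tH₂ + a₀QᵀQ)` (`i = 1, 2`; `0 ≤ c`, `0 ≤ a₀`) and the row bound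
`⟨w, 𝒮(H + sH₁ + tH₂, Q)w⟩ ≤ Λ|w|²` ⟹ on the whole complex bidisc `‖𝒮(Ĥ + z₁Ĥ₁ + z₂Ĥ₂, Q̂)(x,y)‖ ≤ (1 + 2ρc·√(2 + (2ρc)²))·(Λ + a₀) + a₀`. -/
theorem norm_effForm_affine₂_le_of_real (hc : 0 ≤ c) (ha : 0 ≤ a₀)
    (hA : ∀ s t : ℝ, |s| < ρ → |t| < ρ → (H + s • H₁ + t • H₂).PosSemidef)
    (hk : ∀ s t : ℝ, |s| < ρ → |t| < ρ → IsUnit (kkt (H + s • H₁ + t • H₂) Q).det)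
    (hsec : ∀ s t : ℝ, |s| < ρ → |t| < ρ →
      (c • (H + s • H₁ + t • H₂ + Qᵀ * (a₀ • (1 : Matrix μ μ ℝ)) * Q) - H₁).PosSemidef ∧
        (c • (H + s • H₁ + t • H₂ + Qᵀ * (a₀ • (1 : Matrix μ μ ℝ)) * Q) + H₁).PosSemidef ∧
        (c • (H + s • H₁ + t • H₂ + Qᵀ * (a₀ • (1 : Matrix μ μ ℝ)) * Q) - H₂).PosSemidef ∧
        (c • (H + s • H₁ + t • H₂ + Qᵀ * (a₀ • (1 : Matrix μ μ ℝ)) * Q) + H₂).PosSemidef)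
    (hΛ : ∀ s t : ℝ, |s| < ρ → |t| < ρ → ∀ w : μ → ℝ, w ⬝ᵥ (effForm (H + s • H₁ + t • H₂) Q *ᵥ w) ≤ Λ * (w ⬝ᵥ w)) :
    ∀ z ∈ ball (0 : ℂ) ρ ×ˢ ball (0 : ℂ) ρ, ∀ x y : μ,
      ‖effForm (H.map (Complex.ofRealHom : ℝ →+* ℂ) + z.1 • H₁.map Complex.ofRealHom + z.2 • H₂.map Complex.ofRealHom)
          (Q.map Complex.ofRealHom) x y‖ ≤ (1 + 2 * ρ * c * Real.sqrt (2 + (2 * ρ * c) ^ 2)) * (Λ + a₀) + a₀ := by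
  intro z hz x y
  have hρ : 0 < ρ := (norm_nonneg _).trans_lt (mem_ball_zero_iff.mp hz.1)
  obtain ⟨hx1, hx2, hy1, hy2⟩ := re_im_lt_of_mem_bidisc hz
  obtain ⟨hm₁, hp₁, hm₂, hp₂⟩ := hsec _ _ hx1 hx2
  have hH₁ : H₁ᵀ = H₁ := transpose_eq_of_loewner hm₁ hp₁
  have hH₂ : H₂ᵀ = H₂ := transpose_eq_of_loewner hm₂ hp₂
  have hK : (z.1.im • H₁ + z.2.im • H₂)ᵀ = z.1.im • H₁ + z.2.im • H₂ := by
    rw [transpose_add, transpose_smul, transpose_smul, hH₁, hH₂]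
  have hAa := posSemidef_add_reg (Q := Q) (hA _ _ hx1 hx2) ha
  obtain ⟨hKm, hKp⟩ := loewner_of_jet_letters hAa hc hm₁ hp₁ hm₂ hp₂ hy1.le hy2.le
  rw [affine₂_map_eq_accretive]
  exact norm_effForm_accretive_apply_le_of_reg ha (hA _ _ hx1 hx2) hK (hk _ _ hx1 hx2)
    (mul_nonneg (mul_nonneg (by norm_num) hρ.le) hc) hKm hKp (hΛ _ _ hx1 hx2) x y

end Slice

/-! ## §2 PART 32's capstone on the axial slice with S2 discharged -/

section Capstone

variable {c : Type*} [Fintype c] [DecidableEq c]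
variable {ν : ℕ → Type*} [∀ k, Fintype (ν k)] [∀ k, DecidableEq (ν k)]
variable {H H₁ H₂ : ∀ k, Matrix (ν k) (ν k) ℝ} {Q : ∀ k, Matrix c (ν k) ℝ}
variable {Qf : ∀ k, ℝ → ℝ → Matrix (ν k) (ν (k + 1)) ℝ} {P : ∀ k, ℝ → ℝ → Matrix (ν (k + 1)) (ν k) ℝ}
variable {G : ∀ k, ℝ → ℝ → Matrix (ν k) (ν k) ℝ}
variable {ρ s₁ cj a₀ cε cδ cε' cδ' cϱ Λ N θ : ℝ}

/-- **`dEffForm_step_rateω_of_stabGram_of_prolGram_of_row_of_real` — THE CAPSTONE OF THE ROW-DEFECT SQUEEZE WITH S2 DISCHARGED ON THE AXIAL SLICE**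
[our proof; PART 32 + §1 BY NAME]: real affine two-bond towers `(H_k + sH₁ₖ + tH₂ₖ, Q_k)` whose constraint maps DO NOT MOVE (`Q₁ₖ = Q₂ₖ = 0`), with
one-step averagings `Qf_k(s,t)`, prolongations `P_k(s,t)` and symmetric mass forms `G_k(s,t)`, such that (i) ON THE REAL BIDISC `|s|, |t| < ρ`
(`0 < s₁`, `s₁·cosh 1 < ρ`): the fine forms are PSD with nonsingular bordered matrices, the SECTOR LETTER `±H_iₖ ≤ cj·(H_k + sH₁ₖ + tH₂ₖ + a₀Q_kᵀQ_k)`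
holds (`0 ≤ cj`, `0 ≤ a₀`; k-uniform) and `⟨w, 𝒮_k(s,t)w⟩ ≤ Λ|w|²` (`0 < Λ`); (ii) ON THE REAL SQUARE `[0,s₁]²`: `Q_{k+1} = Q_k·Qf_k`, (STAB-ε′_k,δ′_k),
(PROL-ε_k,δ_k), (ROW_k) `≤ cϱ·(θ^k)²` and the Gram bound `N` — exactly PART 32's hypotheses MINUS S2 ⟹ for every `r ∈ ]0,1]` and `k`:
`‖dEffForm_{k+1} − dEffForm_k‖ ≤ 25·(2B)^r∕(s₁r²)·C^{1−r}·(θ^{1−r})^k` with `B = (1 + 2ρ·cj·√(2 + (2ρ·cj)²))·(Λ + a₀) + a₀`,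
`C = (1 + cε + 2cε′ + cϱ)·Λ + (cδ + 2cδ′)·N` (complexified letters; first bond direction; the `Q`-jet of `dEffForm` is `0`). -/
theorem dEffForm_step_rateω_of_stabGram_of_prolGram_of_row_of_real (hs₁ : 0 < s₁) (hs₁ρ : s₁ * Real.cosh 1 < ρ) (hcj : 0 ≤ cj) (ha₀ : 0 ≤ a₀)
    (hA : ∀ k (s t : ℝ), |s| < ρ → |t| < ρ → (H k + s • H₁ k + t • H₂ k).PosSemidef)
    (hk : ∀ k (s t : ℝ), |s| < ρ → |t| < ρ → IsUnit (kkt (H k + s • H₁ k + t • H₂ k) (Q k)).det)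
    (hsec : ∀ k (s t : ℝ), |s| < ρ → |t| < ρ →
      (cj • (H k + s • H₁ k + t • H₂ k + (Q k)ᵀ * (a₀ • (1 : Matrix c c ℝ)) * Q k) - H₁ k).PosSemidef ∧
        (cj • (H k + s • H₁ k + t • H₂ k + (Q k)ᵀ * (a₀ • (1 : Matrix c c ℝ)) * Q k) + H₁ k).PosSemidef ∧
        (cj • (H k + s • H₁ k + t • H₂ k + (Q k)ᵀ * (a₀ • (1 : Matrix c c ℝ)) * Q k) - H₂ k).PosSemidef ∧
        (cj • (H k + s • H₁ k + t • H₂ k + (Q k)ᵀ * (a₀ • (1 : Matrix c c ℝ)) * Q k) + H₂ k).PosSemidef)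
    (hΛ : ∀ k (s t : ℝ), |s| < ρ → |t| < ρ → ∀ w : c → ℝ, w ⬝ᵥ (effForm (H k + s • H₁ k + t • H₂ k) (Q k) *ᵥ w) ≤ Λ * (w ⬝ᵥ w))
    (hcomp : ∀ k (s t : ℝ), 0 ≤ s → s ≤ s₁ → 0 ≤ t → t ≤ s₁ → Q (k + 1) = Q k * Qf k s t)
    (hG : ∀ k (s t : ℝ), (G k s t)ᵀ = G k s t) (hcε : 0 ≤ cε) (hcδ : 0 ≤ cδ) (hcε' : 0 ≤ cε') (hcδ' : 0 ≤ cδ') (hΛ0 : 0 < Λ) (hN0 : 0 ≤ N)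
    (hstab : ∀ k (s t : ℝ), 0 ≤ s → s ≤ s₁ → 0 ≤ t → t ≤ s₁ →
      ((1 + cε' * θ ^ k) • (H (k + 1) + s • H₁ (k + 1) + t • H₂ (k + 1)) + (cδ' * θ ^ k) • G (k + 1) s t
        - (Qf k s t)ᵀ * (H k + s • H₁ k + t • H₂ k) * Qf k s t).PosSemidef)
    (hprol : ∀ k (s t : ℝ), 0 ≤ s → s ≤ s₁ → 0 ≤ t → t ≤ s₁ →
      ((1 + cε * θ ^ k) • (H k + s • H₁ k + t • H₂ k) + (cδ * θ ^ k) • G k s t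
        - (P k s t)ᵀ * (H (k + 1) + s • H₁ (k + 1) + t • H₂ (k + 1)) * P k s t).PosSemidef)
    (hrow : ∀ k (s t : ℝ), 0 ≤ s → s ≤ s₁ → 0 ≤ t → t ≤ s₁ → ∀ y : c,
      (Q (k + 1) *ᵥ (P k s t *ᵥ (minOp (H k + s • H₁ k + t • H₂ k) (Q k) *ᵥ Pi.single y 1)) - Pi.single y 1) ⬝ᵥ
        (Q (k + 1) *ᵥ (P k s t *ᵥ (minOp (H k + s • H₁ k + t • H₂ k) (Q k) *ᵥ Pi.single y 1)) - Pi.single y 1) ≤ cϱ * (θ ^ k) ^ 2)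
    (hcϱ : 0 ≤ cϱ)
    (hN : ∀ k (s t : ℝ), 0 ≤ s → s ≤ s₁ → 0 ≤ t → t ≤ s₁ → ∀ a b : c,
      |((minOp (H k + s • H₁ k + t • H₂ k) (Q k))ᵀ * G k s t * minOp (H k + s • H₁ k + t • H₂ k) (Q k)) a b| ≤ N)
    (hθ : 0 < θ) {r : ℝ} (hr : 0 < r) (hr1 : r ≤ 1) (k : ℕ) (a b : c) :
    ‖dEffForm ((H (k + 1)).map Complex.ofRealHom) ((Q (k + 1)).map Complex.ofRealHom) ((H₁ (k + 1)).map Complex.ofRealHom)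
          (0 : Matrix c (ν (k + 1)) ℂ) a b
        - dEffForm ((H k).map Complex.ofRealHom) ((Q k).map Complex.ofRealHom) ((H₁ k).map Complex.ofRealHom)
          (0 : Matrix c (ν k) ℂ) a b‖ ≤
      25 * (2 * ((1 + 2 * ρ * cj * Real.sqrt (2 + (2 * ρ * cj) ^ 2)) * (Λ + a₀) + a₀)) ^ r / (s₁ * r ^ 2)
        * ((1 + cε + 2 * cε' + cϱ) * Λ + (cδ + 2 * cδ') * N) ^ (1 - r) * (θ ^ (1 - r)) ^ k := by
  -- the real square `[0,s₁]²` sits inside the real bidisc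
  have hs₁ρ' : s₁ < ρ := lt_of_le_of_lt (le_mul_of_one_le_right hs₁.le (Real.one_le_cosh 1)) hs₁ρ
  have hsq : ∀ s : ℝ, 0 ≤ s → s ≤ s₁ → |s| < ρ := fun s hs0 hs1 => by rw [abs_of_nonneg hs0]; linarith
  have hQ : ∀ k (s t : ℝ), Q k + s • (0 : Matrix c (ν k) ℝ) + t • (0 : Matrix c (ν k) ℝ) = Q k := fun k s t => by simp
  have hQc : ∀ k (z : ℂ × ℂ), (Q k).map (Complex.ofRealHom : ℝ →+* ℂ) + z.1 • (0 : Matrix c (ν k) ℝ).map Complex.ofRealHom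
      + z.2 • (0 : Matrix c (ν k) ℝ).map Complex.ofRealHom = (Q k).map Complex.ofRealHom := fun k z => by simp
  have hρ0 : |(0:ℝ)| < ρ := by simpa using hs₁.trans hs₁ρ'
  have hH₁ : ∀ k, (H₁ k)ᵀ = H₁ k := fun k => transpose_eq_of_loewner (hsec k 0 0 hρ0 hρ0).1 (hsec k 0 0 hρ0 hρ0).2.1
  have hH₂ : ∀ k, (H₂ k)ᵀ = H₂ k := fun k => transpose_eq_of_loewner (hsec k 0 0 hρ0 hρ0).2.2.1 (hsec k 0 0 hρ0 hρ0).2.2.2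
  have hdet : ∀ k, ∀ z ∈ ball (0 : ℂ) ρ ×ˢ ball (0 : ℂ) ρ,
      IsUnit (kkt ((H k).map Complex.ofRealHom + z.1 • (H₁ k).map Complex.ofRealHom + z.2 • (H₂ k).map Complex.ofRealHom)
        ((Q k).map Complex.ofRealHom + z.1 • (0 : Matrix c (ν k) ℝ).map Complex.ofRealHom
          + z.2 • (0 : Matrix c (ν k) ℝ).map Complex.ofRealHom)).det := fun k z hz => by
    rw [hQc]; exact isUnit_det_kkt_affine₂_of_real (hA k) (hk k) (hH₁ k) (hH₂ k) z hz
  have hB : ∀ k, ∀ z ∈ ball (0 : ℂ) ρ ×ˢ ball (0 : ℂ) ρ, ∀ a b : c,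
      ‖effForm ((H k).map Complex.ofRealHom + z.1 • (H₁ k).map Complex.ofRealHom + z.2 • (H₂ k).map Complex.ofRealHom)
        ((Q k).map Complex.ofRealHom + z.1 • (0 : Matrix c (ν k) ℝ).map Complex.ofRealHom
          + z.2 • (0 : Matrix c (ν k) ℝ).map Complex.ofRealHom) a b‖ ≤
        (1 + 2 * ρ * cj * Real.sqrt (2 + (2 * ρ * cj) ^ 2)) * (Λ + a₀) + a₀ := fun k z hz a b => by
    rw [hQc]; exact norm_effForm_affine₂_le_of_real hcj ha₀ (hA k) (hk k) (hsec k) (hΛ k) z hz a b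
  have key := dEffForm_step_rateω_of_stabGram_of_prolGram_of_row (Q₁ := fun k => 0) (Q₂ := fun k => 0) (Qf := Qf) (P := P) (G := G)
    hs₁ hs₁ρ hdet hB
    (fun k s t hs0 hs1 ht0 ht1 => hA k s t (hsq s hs0 hs1) (hsq t ht0 ht1))
    (fun k s t hs0 hs1 ht0 ht1 => by rw [hQ, hQ]; exact hcomp k s t hs0 hs1 ht0 ht1)
    hG hcε hcδ hcε' hcδ' hΛ0 hN0 hstab hprol
    (fun k s t hs0 hs1 ht0 ht1 y => by rw [hQ, hQ]; exact hrow k s t hs0 hs1 ht0 ht1 y) hcϱ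
    (fun k s t hs0 hs1 ht0 ht1 w => by rw [hQ]; exact hΛ k s t (hsq s hs0 hs1) (hsq t ht0 ht1) w)
    (fun k s t hs0 hs1 ht0 ht1 a b => by rw [hQ]; exact hN k s t hs0 hs1 ht0 ht1 a b) hθ hr hr1 k a b
  simpa only [Matrix.map_zero _ (map_zero Complex.ofRealHom)] using key

end Capstone

end Summit.QuantumFields.BalabanUV.Beta.GAN24.DerivativeRateTransferAccretiveEnd

end
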